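/-
Copyright (c) 2026 the pub-hodgecm-mathlib formalisation cell (harness21).  Typer seat hodgecm-mathlib-typ-T5a (g0), topic T5 = P8
«(C♯)hol interior», 2026-08-31.  VOCABULARY module: ONE definition with body + unfolding lemmas; no named fact, no `sorry`,
no instance, no notation.
-/
import Literature.NumberTheory.Automorphic.UnitaryGroupCohomologicalForms
import Literature.NumberTheory.Automorphic.Liu2021.Def411WeilCarriers
import Literature.NumberTheory.Automorphic.Liu2021.Def411WeilCarriersDoubling
import Literature.NumberTheory.Automorphic.IdeleClassCharacterHecke
import Literature.NumberTheory.GelbartRogawski1991.UnitaryDualPairThetaKernel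
import Literature.NumberTheory.Weil1964.ThetaLift
import Literature.RepresentationTheory.Liu2021.OscillatorConventions
import HarnessLib

/-!
# «`V_π = Θ^V_{(μ⁻¹,ν⁻¹)}^{−W}(π_W)`» — a discrete automorphic representation of `U(H)` MEETS THE GLOBAL THETA CORRESPONDENCE
# from the hermitian LINE `⟨a⟩` with the `μ`-attached splitting ([Liu2021, proof of Prop. 4.13, Case 1]; the D1 seam of letter (C♯)hol)

Topic `NumberTheory/Automorphic/Liu2021`; namespace `Literature.NumberTheory.Automorphic.Liu2021`.  DEFINITION WITH BODY
(`MeetsThetaLiftFromLine`) + two unfolding lemmas; nothing is asserted.  Cell hodgecm-mathlib FLOOR 0, programme P2, topic T5 = P8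
(director g16 PLAN-THROUGHPUT §4): the INTERMEDIATE OBJECT along which the printed proof of [Liu2021, Prop. 4.13] cuts the booked
letter (C♯)hol `Literature.NumberTheory.Rogawski1990.cohFinComponent_isThetaSigned_hol` (★ p824128) into its D1 half (global
theta lift from `U(1)`: «`V_π = Θ(π_W)`», l. 2131–2136) and its D2 half (archimedean Weil dictionary, Lem. D.2, l. 2137–2141).

PRINT [Liu2021, proof of Prop. 4.13, Case 1, FJcycle.tex l. 2131–2136; Camb. J. Math. 9 (2021) p. 48]: «Suppose that `π`
contributes to the Albanese and `m_cusp(π) > 0`.  Let `V_π` be a cuspidal realization of `π` … Thus, we must have `s₀ = n/2`.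
By Theorem B.4, we have a one-dimensional skew-hermitian space `W` such that `Θ^W_{(μ,ν),V}(V_π)` [is non-zero] and is cuspidal.
By Corollary B.6 (1), we have `V_π = Θ^V_{(μ⁻¹,ν⁻¹),−W}(π_W)`.  …  In other words, there is a unique element
`e ∈ E^{−×}/Nm_{E/F}E^×` determined by `W` such that `π^∞ ≃ ω(μ, ε_e, χ)`.»  App. B before Thm. B.4 (l. 4257–4262; p. 97):
«the global theta lifting map `Θ^W_{μ,V}` … `Θ^W_{μ,V}(V)` is spanned by functions `h ↦ ∫_{G(F)\G(𝔸_F)} θ_μ(g,h) f(g) dg` … for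
`f ∈ V`.  Similarly, we have the reverse global theta lifting map `Θ^V_{μ,W}`.»

THE TREE'S CURRENCY (all ★, nothing re-declared).  `U(H)` is the adelic group datum `UnitaryGroup.adelicGroupData L⁺ L c̄ N H`
(★ `UnitaryGroupAutomorphicRep`), `P : DiscreteAutomorphicRep … μA` an irreducible closed invariant subspace of
`L²(U(H)(L⁺)\U(H)(𝔸_{L⁺}), μA)` (★ `AutomorphicSpectrum`); Liu's one-dimensional skew-hermitian `W = ⟨e⟩`, `e ∈ L^{×−}`, is the
hermitian LINE `⟨a⟩`, `a ∈ (L⁺)ˣ`, of the Weil-carrier lane (`e = a·δ′`, `δ′ = (2·imagUnit L)⁻¹`, ★ `Def411WeilCarriers.TW ∕ JW`;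
[Liu2021, App. D §D.1 Step 1]); the pair splitting «`ι_{(μ,ν)}`» is the tree's `μ`-ATTACHED compatible splitting of the dual
pair `U(diag dV) × U(⟨a⟩)` ★ `Def411WeilCarriersDoubling.chiSplittingLine … (toHeckeCharacter L μ) …` ([Liu2021, App. D Step 2]
`ι_μ`; [HarrisKudlaSweet1996, §1]; [GelbartRogawski1991, Prop. 3.1.1]) — the SAME splitting over which (C♯)hol's carrier
`rhoAtLine … a χ` is built, so that the local–global node (B) of the T5 tree compares like with like; the theta kernel and the
theta lift `Θ_Φ(f)(g) = ∫_{[U(⟨a⟩)]} θ_Φ(g, h) f(h) dμ_W(h)` are ★ `UnitaryDualPair.thetaKernelDatum` ([Weil1964, n° 41 Thm. 6]) and ★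
`Weil1964.ThetaKernelDatum.thetaLiftFun` ([FleigEtAl2018, (12.37)]); the frame `H ≅ diag dV` is transported by a homomorphism
`ιA : U(H)(𝔸) →* U(diag dV)(𝔸)` which the CONSUMER pins extensionally (`k ↦ g_𝔸⁻¹ k g_𝔸`, as (C♯)hol pins its finite-adelic `ιV`);
`L²`-classes on the automorphic quotient are read through ★ `CotangentForms.toQuotFun` exactly as in ★ `DiscreteAutomorphicRep.ContainsForm`.

DEFINITION.  `MeetsThetaLiftFromLine L N H e₁ dV hdV hdV0 P μ hμ a ιA` := there exist Weil majorants for the `μ`-splitting at the line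
(a witness slot, [Weil1964, n° 41 Lemme 5]; the values of the lift do not depend on it), a finite `U(⟨a⟩)(𝔸)`-invariant Borel measure
`μ_W` on the compact abelian group `[U(⟨a⟩)]`, a weight `f ∈ C([U(⟨a⟩)], ℂ)` and a Schwartz–Bruhat `Φ`, such that the `L²`-class of the
automorphic function `x ↦ Θ̃_Φ(f)(ιA x)` on `U(H)(𝔸_{L⁺})` is a NON-ZERO VECTOR OF `P`.  Since `P` is irreducible and right translates
of theta lifts are theta lifts (★ `thetaLiftFun_mul_right`), this is the tree's reading of «`V_π ⊆ Θ^V(𝒜(U(W)))`», i.e. of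
«`V_π = Θ^V_{−W}(π_W)` for some automorphic `π_W`» once `f` is resolved into characters of the compact abelian `[U(W)]`
(★ `UnitaryDualPairThetaLiftCharacterSpan`).  The weight `f` is deliberately NOT required to be a character here: node (B) of the
tree produces the character `χ` (Liu's «`χ` = the central character of `π`»).

HONEST SCOPE / NOT HERE.  Nothing about poles of `L^S(s, π × μ)`, Eisenstein series or [Liu2021, Thm. B.4 ∕ Cor. B.5 ∕ Cor. B.6]
(no carriers in the tree; they are the PRINTED ROAD to the letter `cohHol_meetsThetaLiftFromLine` of the sibling module, recorded
there); nothing archimedean (node (C)); no non-vanishing (programme P4's converse direction, ★ `Li1992/*`).  Over an arbitrary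
`ιA` the predicate is about `P` pulled back along `ιA`; consumers supply `hιA`.  HC_CM is proved only modulo the printed citations
until rung 0 closes; this file asserts nothing.

## References
* [Liu2021] Y. Liu, *Fourier–Jacobi cycles and arithmetic relative trace formula*, Camb. J. Math. 9 (2021) = arXiv:2102.11518:
  proof of Prop. 4.13 Case 1 (l. 2131–2137, p. 48); App. B §B.2 (l. 4257–4262, p. 97), Def. B.2 (realization); App. D §D.1 Steps 1–3.
* [Weil1964] A. Weil, Acta Math. 111 (1964), Chap. III n° 41, Lemme 5 p. 192, Thm. 6 p. 193.
* [FleigEtAl2018] P. Fleig, H. Gustafsson, A. Kleinschmidt, D. Persson, CUP (2018), §12.3 Def. 12.5 (12.37)–(12.38) p. 296.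
* [GelbartRogawski1991] S. Gelbart, J. Rogawski, Invent. Math. 105 (1991), §3.1 Prop. 3.1.1 p. 455, §3.2 p. 457.
* [HarrisKudlaSweet1996] M. Harris, S. Kudla, W. J. Sweet, J. AMS 9 (1996), §1 (1.5)–(1.8).
-/

noncomputable section

open NumberField MeasureTheory IsDedekindDomain
open scoped Matrix ComplexOrder

namespace Literature.NumberTheory.Automorphic.Liu2021

open _root_.MeasureTheory
open Literature.NumberTheory.Automorphic Literature.NumberTheory.Automorphic.UnitaryGroup
open Literature.NumberTheory.Automorphic.UnitaryGroup.CotangentForms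
open Literature.NumberTheory.Automorphic.IdeleClassGroup
open Literature.NumberTheory.Automorphic.Liu2021.Def411WeilCarriers
open Literature.NumberTheory.Automorphic.Liu2021.Def411WeilCarriersDoubling
open Literature.NumberTheory.GelbartRogawski1991 Literature.NumberTheory.GelbartRogawski1991.UnitaryDualPair
open Literature.NumberTheory.Weil1964
open Literature.RepresentationTheory.Liu2021

variable (L : Type) [Field L] [NumberField L] [IsCMField L] (N : ℕ) (H : Matrix (Fin N) (Fin N) L)
  {n' : ℕ} (e₁ : Fin N × Fin 1 ≃ Fin n') (dV : Fin N → L) (hdV : ∀ i, IsCMField.complexConj L (dV i) = dV i)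
  (hdV0 : ∀ i, dV i ≠ 0)
  {μA : Measure (adelicGroupData (↥(maximalRealSubfield L)) L (IsCMField.complexConj L) N H).automorphicQuotient}
  [(adelicGroupData (↥(maximalRealSubfield L)) L (IsCMField.complexConj L) N H).IsAutomorphicMeasure μA]

/-- **The theta-kernel datum of the pair `U(diag dV) × U(⟨a⟩)` at the `μ`-attached splitting** `chiSplittingLine … (toHeckeCharacter L μ) …`
— [Liu2021, App. D §D.1 Steps 1–2]'s `ω(ε) ∘ ι_μ` for `V = ⟨diag dV⟩`, `W = ⟨a⟩`, globally over `𝔸_{L⁺}` ([Weil1964, n° 41 Thm. 6]),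
with the full Schwartz–Bruhat space as index set.  An abbreviation (★ `UnitaryDualPair.thetaKernelDatum` at these arguments).
[cite: Liu2021, App. D §D.1 Steps 1–2 (l. 5217–5219); App. B §B.2 (l. 4257–4262)] -/
abbrev lineThetaKernelDatum (μ : Literature.NumberTheory.Automorphic.IdeleClassGroup L →ₜ* Circle) (hμ : IsConjugateSymplectic L μ)
    (a : (↥(maximalRealSubfield L))ˣ)
    (hρ : HasThetaMajorants fun
      (p : ↥(UnitaryGroup.adelic (↥(maximalRealSubfield L)) L (IsCMField.complexConj L) N (Matrix.diagonal dV)) ×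
        ↥(UnitaryGroup.adelic (↥(maximalRealSubfield L)) L (IsCMField.complexConj L) 1 (JW (↥(maximalRealSubfield L)) L a)))
      (Φ : piSchwartzBruhat (↥(maximalRealSubfield L)) (Fin n')) =>
        pairRep (↥(maximalRealSubfield L)) L (IsCMField.complexConj L) N 1 e₁ (Matrix.diagonal dV) (JW (↥(maximalRealSubfield L)) L a)
          (chiSplittingLine L e₁ dV hdV hdV0 (toHeckeCharacter L μ) (isUnitary_toHeckeCharacter L μ)
            ((isOscillatorChar_toHeckeCharacter_iff μ).mpr hμ) (TW (↥(maximalRealSubfield L)) a)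
            (isUnit_det_TW (↥(maximalRealSubfield L)) a) (JW (↥(maximalRealSubfield L)) L a) (JW_eq (↥(maximalRealSubfield L)) L a))
          p Φ) :=
  thetaKernelDatum (↥(maximalRealSubfield L)) L (IsCMField.complexConj L) N 1 e₁ (Matrix.diagonal dV) (JW (↥(maximalRealSubfield L)) L a)
    (complexConj_imagUnit L) (imagUnit_ne_zero L) (imagUnit_mul_self L) (realDiagonal_isSymm L dV hdV)
    (isSymm_TW (↥(maximalRealSubfield L)) a) (isUnit_det_realDiagonal L dV hdV hdV0) (isUnit_det_TW (↥(maximalRealSubfield L)) a)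
    (realDiagonal_map L dV hdV).symm (JW_eq (↥(maximalRealSubfield L)) L a)
    (chiSplittingLine L e₁ dV hdV hdV0 (toHeckeCharacter L μ) (isUnitary_toHeckeCharacter L μ)
      ((isOscillatorChar_toHeckeCharacter_iff μ).mpr hμ) (TW (↥(maximalRealSubfield L)) a)
      (isUnit_det_TW (↥(maximalRealSubfield L)) a) (JW (↥(maximalRealSubfield L)) L a) (JW_eq (↥(maximalRealSubfield L)) L a))
    (isCompatible_chiSplittingLine L e₁ dV hdV hdV0 (toHeckeCharacter L μ) (isUnitary_toHeckeCharacter L μ)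
      ((isOscillatorChar_toHeckeCharacter_iff μ).mpr hμ) (TW (↥(maximalRealSubfield L)) a) (isSymm_TW (↥(maximalRealSubfield L)) a)
      (isUnit_det_TW (↥(maximalRealSubfield L)) a) (JW (↥(maximalRealSubfield L)) L a) (JW_eq (↥(maximalRealSubfield L)) L a))
    hρ Set.univ (fun _ _ _ => Set.mem_univ _)

/-- **`MeetsThetaLiftFromLine L N H e₁ dV hdV hdV0 P μ hμ a ιA`** — «`V_π ⊆ Θ^V_{⟨a⟩, μ}(𝒜(U(⟨a⟩)))`»: the discrete automorphic
representation `P` of `U(H)` contains, as a NON-ZERO vector, the `L²`-class of a global theta lift `x ↦ Θ̃_Φ(f)(ιA x)` from the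
hermitian line `⟨a⟩` at the `μ`-attached splitting (some Weil-majorant witness, some finite invariant measure on `[U(⟨a⟩)]`, some
continuous weight `f`, some Schwartz–Bruhat `Φ`).  This is the tree's reading of [Liu2021]'s «`V_π = Θ^V_{(μ⁻¹,ν⁻¹),−W}(π_W)`»
(proof of Prop. 4.13, Case 1): by irreducibility of `P` and ★ `thetaLiftFun_mul_right`, one non-zero theta vector in `P` makes
`P` the closed span of theta lifts from `⟨a⟩`.  Nothing is asserted.
[cite: Liu2021, proof of Prop. 4.13 Case 1 (l. 2131–2137, p. 48); App. B §B.2 (l. 4257–4262)] [cite: FleigEtAl2018, §12.3 Def. 12.5 (12.37)] -/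
def MeetsThetaLiftFromLine (P : DiscreteAutomorphicRep (adelicGroupData (↥(maximalRealSubfield L)) L (IsCMField.complexConj L) N H) μA)
    (μ : Literature.NumberTheory.Automorphic.IdeleClassGroup L →ₜ* Circle) (hμ : IsConjugateSymplectic L μ)
    (a : (↥(maximalRealSubfield L))ˣ)
    (ιA : (adelicGroupData (↥(maximalRealSubfield L)) L (IsCMField.complexConj L) N H).Adelic →*
      ↥(UnitaryGroup.adelic (↥(maximalRealSubfield L)) L (IsCMField.complexConj L) N (Matrix.diagonal dV)))
    [CompactSpace (↥(UnitaryGroup.adelic (↥(maximalRealSubfield L)) L (IsCMField.complexConj L) N (Matrix.diagonal dV)) ⧸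
      (UnitaryGroup.toAdelic (↥(maximalRealSubfield L)) L (IsCMField.complexConj L) N (Matrix.diagonal dV)).range)] : Prop :=
  letI : MeasurableSpace (↥(UnitaryGroup.adelic (↥(maximalRealSubfield L)) L (IsCMField.complexConj L) 1
      (JW (↥(maximalRealSubfield L)) L a)) ⧸
        (UnitaryGroup.toAdelic (↥(maximalRealSubfield L)) L (IsCMField.complexConj L) 1 (JW (↥(maximalRealSubfield L)) L a)).range) :=
    borel _
  ∃ (hρ : HasThetaMajorants fun
      (p : ↥(UnitaryGroup.adelic (↥(maximalRealSubfield L)) L (IsCMField.complexConj L) N (Matrix.diagonal dV)) ×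
        ↥(UnitaryGroup.adelic (↥(maximalRealSubfield L)) L (IsCMField.complexConj L) 1 (JW (↥(maximalRealSubfield L)) L a)))
      (Φ : piSchwartzBruhat (↥(maximalRealSubfield L)) (Fin n')) =>
        pairRep (↥(maximalRealSubfield L)) L (IsCMField.complexConj L) N 1 e₁ (Matrix.diagonal dV) (JW (↥(maximalRealSubfield L)) L a)
          (chiSplittingLine L e₁ dV hdV hdV0 (toHeckeCharacter L μ) (isUnitary_toHeckeCharacter L μ)
            ((isOscillatorChar_toHeckeCharacter_iff μ).mpr hμ) (TW (↥(maximalRealSubfield L)) a)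
            (isUnit_det_TW (↥(maximalRealSubfield L)) a) (JW (↥(maximalRealSubfield L)) L a) (JW_eq (↥(maximalRealSubfield L)) L a))
          p Φ)
    (μW : Measure (↥(UnitaryGroup.adelic (↥(maximalRealSubfield L)) L (IsCMField.complexConj L) 1
      (JW (↥(maximalRealSubfield L)) L a)) ⧸
        (UnitaryGroup.toAdelic (↥(maximalRealSubfield L)) L (IsCMField.complexConj L) 1 (JW (↥(maximalRealSubfield L)) L a)).range))
    (_ : IsFiniteMeasure μW)
    (_ : SMulInvariantMeasure
      (↥(UnitaryGroup.adelic (↥(maximalRealSubfield L)) L (IsCMField.complexConj L) 1 (JW (↥(maximalRealSubfield L)) L a)))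
      (↥(UnitaryGroup.adelic (↥(maximalRealSubfield L)) L (IsCMField.complexConj L) 1 (JW (↥(maximalRealSubfield L)) L a)) ⧸
        (UnitaryGroup.toAdelic (↥(maximalRealSubfield L)) L (IsCMField.complexConj L) 1 (JW (↥(maximalRealSubfield L)) L a)).range)
      μW)
    (f : C(↥(UnitaryGroup.adelic (↥(maximalRealSubfield L)) L (IsCMField.complexConj L) 1 (JW (↥(maximalRealSubfield L)) L a)) ⧸
      (UnitaryGroup.toAdelic (↥(maximalRealSubfield L)) L (IsCMField.complexConj L) 1 (JW (↥(maximalRealSubfield L)) L a)).range, ℂ))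
    (Φ : piSchwartzBruhat (↥(maximalRealSubfield L)) (Fin n'))
    (hθ : MemLp (toQuotFun (adelicGroupData (↥(maximalRealSubfield L)) L (IsCMField.complexConj L) N H) fun x =>
      (lineThetaKernelDatum L N e₁ dV hdV hdV0 μ hμ a hρ).thetaLiftFun μW Φ f (ιA x)) 2 μA),
    MemLp.toLp _ hθ ∈ P.space.toSubmodule ∧ MemLp.toLp _ hθ ≠ 0

end Literature.NumberTheory.Automorphic.Liu2021

end
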